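import Summits.BirchSwinnertonDyer.Rank1Residual.Additive.GoodSupersingularPadicModel
import HarnessLib

/-!
# CLASS-LEVEL transversality of the η-odd Kummer line to Kobayashi's `E⁻` for the tower
# `K₀·K_n^κ` at `E = ℚ_p`, from `hsum` ALONE — the NET LOCAL STATUS of the series as ONE kernel
# statement for a globally minimal good supersingular curve (cell `b2b-bsdres`, CLASS-CLOSURE lane,
# class O10 — x1b GEN 32, class lead; file 11 of the local series p312958 … p317003)

HONEST FRAMING (cell `b2b-bsdres`, run/shared/lean/b2b/bsd-rank1-residual/, verbatim in every
file): the goal of the cell is to DELETE the COMBINATION-SHAPED residual classes of the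
Birch–Swinnerton-Dyer formula for ALL analytic-rank `≤ 1` elliptic curves over `ℚ` — "full BSD
formula for every rank `≤ 1` curve in class `C`" assembled STRICTLY from published theorems — so
that the rank-`≤ 1` remainder becomes exactly the CONSTRUCTION-SHAPED classes, which are TYPED
(missing-input `Prop`s), NOT attempted. This is not "finishing BSD". CLASS-CLOSURE lane: prove
what is provable now; shrink each hard class to its core with data; no claim beyond stated classes;
research routes on CONSTRUCTION-SHAPED X12 / O10; census / instrument output = EVIDENCE / conjecture
items, NEVER a Literature fact; `RESIDUAL-MAP.md` marks change only by signed lines. THIS FILE: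
RE-EXPORTS ONLY (x1b GEN 31's class-level transversality p314385 / GEN 32 file 5's `_of_bottom`
form, specialised to cc-typer-6's tower `towerSubgroup κ K₀` at `E = ℚ_p` with the bottom-layer
torsion hypothesis supplied by files 6/8) — no definition, no named Literature fact, no Summits-side
fact `def`, no `sorry`, axioms standard; the ONLY remaining local hypothesis is `hsum` (Prop. 8.12 ii)
generation half at layer `n`); nothing is booked; no label / mark / count / sub-cell moves; O10 stays
OPEN / CONSTRUCTION-SHAPED; nothing about `BSD(W, p)` of any pair is claimed.

## What is proved

* **`not_mem_localKummerOverOfEmb_neg_one_of_kummer_generator_towerSubgroup_padic`** — `K` a number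
  field with `K → ℚ_p`, `K₀/K` Galois with `[Γ_K : Gal(K̄/K₀)] < (p² − 1)/2` (Kobayashi: `K = ℚ`,
  `K₀ = ℚ(μ_p)`), `p ≥ 3`, `W/K` with a good supersingular `ℤ_p`-model `M` (`M ⊗ ℚ̄_p = W ⊗ ℚ̄_p`):
  for an η-odd bottom point `g ∈ E(K_{0,v})` (`τ₀ • g = −g`) NOT `p`-divisible in `E(K_{0,v})`, no
  class of `H¹(Gal(K̄/K₀K_n), E[p^∞])` restricting at `ι` to the Kummer class of `g ⊗ p^{−1}` lies in
  the Kummer condition cut out by `E⁻(K_{n,v})` — i.e. `C⁻_{η,n} ∩ (Kummer line)[p] = 0`, the local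
  constant `u(p) = 0` of the (C3_η) anatomy — given ONLY `hsum` at layer `n`.
* `…_of_goodSupersingular` — the same for `W ⊗ ℚ̄_p = V ⊗ ℚ̄_p` with `V/ℚ` elliptic, globally
  minimal, `V.HasGoodReductionAtPrime p`, `V.frobeniusTrace p = 0` (no model hypothesis; file 8's
  `exists_goodSupersingularPadicModel`), `[K₀ : K] < (p² − 1)/2`.

References: [Kobayashi2003] §2 p. 4, Def. 2.1 (p. 5), Prop. 8.7 (p. 16), Prop. 8.12 ii)
(pp. 17–18), Lemma 8.17 (p. 19); [SerreInventiones1972] §1.11 Prop. 12.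
-/

noncomputable section

open scoped Classical

namespace Summit.BirchSwinnertonDyer.Rank1Residual.Additive

open Literature.NumberTheory.EllipticCurves Literature.NumberTheory.GaloisRepresentations
  Literature.NumberTheory.EllipticCurves.Kobayashi2003 ZpExtension WeierstrassCurve

variable {p : ℕ} [hp : Fact p.Prime] {K : Type} [Field K] [NumberField K] [Algebra K ℚ_[p]]
  (κ : ZpExtension K p) (K₀ : Type) [Field K₀] [NumberField K₀] [Algebra K K₀]
  [(galRange (K := K) K₀).Normal]
  (ι : AlgebraicClosure K →ₐ[K] AlgebraicClosure ℚ_[p]) (W : WeierstrassCurve K) [W.IsElliptic]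

/-- **Class-level transversality for the tower `K₀·K_n^κ` at `E = ℚ_p`, from `hsum` alone** (x1b GEN
31 p314385 / GEN 32 file 5's `not_mem_localKummerOverOfEmb_neg_one_of_kummer_generator_of_bottom`
with `hidx_towerSubgroup`, `towerSubgroup_antitone` and the bottom torsion hypothesis DISCHARGED by
file 6's `eq_zero_of_prime_smul_eq_zero_localFixedPointsOfEmb_padic_of_normal`): for `g ∈ E(K_{0,v})`
η-odd and not `p`-divisible there, no class of `H¹(Gal(K̄/K₀K_n), E[p^∞])` restricting at `ι` to the
Kummer class of `g ⊗ p^{−1}` lies in the Kummer condition of `E⁻(K_{n,v})`.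
[cite: Kobayashi2003, Def. 2.1 (p. 5), Prop. 8.12 ii) (pp. 17–18), Prop. 8.7 (p. 16)]
[cite: SerreInventiones1972, §1.11 Prop. 12] -/
theorem not_mem_localKummerOverOfEmb_neg_one_of_kummer_generator_towerSubgroup_padic (hp2 : p ≠ 2)
    (M : WeierstrassCurve ℤ_[p]) (hΔ : IsUnit M.Δ)
    (hA : M.hasseCoeff p ∈ IsLocalRing.maximalIdeal ℤ_[p])
    (hWM : M.baseChange (AlgebraicClosure ℚ_[p]) = W.baseChange (AlgebraicClosure ℚ_[p]))
    (hK₀0 : (galRange (K := K) K₀).index ≠ 0) (hK₀ : (galRange (K := K) K₀).index < (p ^ 2 - 1) / 2)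
    (n : ℕ)
    (hsum : localFixedPointsOfEmb ι W (towerSubgroup κ K₀ n) ≤
      towerSignedLocalPointsOfEmb (towerSubgroup κ K₀) ι W 1 n ⊔
        towerSignedLocalPointsOfEmb (towerSubgroup κ K₀) ι W (-1) n)
    {g : localPoints W ℚ_[p]} (hg : g ∈ localFixedPointsOfEmb ι W (towerSubgroup κ K₀ 0))
    {τ₀ : Field.absoluteGaloisGroup ℚ_[p]} (hτ₀ : τ₀ • g = -g)
    (hndiv : ∀ S ∈ localFixedPointsOfEmb ι W (towerSubgroup κ K₀ 0), g ≠ p • S)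
    {c : W.subgroupH1 p (towerSubgroup κ K₀ n)}
    (hcg : ∃ (ψ : contOneCocycles (discreteTopRep (towerSubgroup κ K₀ n) (W.geomPrimaryTorsion p)))
      (Q₁ : localPoints W ℚ_[p]) (j : ℕ),
      oneCocycleClass (discreteTopRep (towerSubgroup κ K₀ n) (W.geomPrimaryTorsion p)) ψ = c ∧
        p ^ (j + 1) • Q₁ = p ^ j • g ∧
        ∀ τ : localSubgroupOfEmb (towerSubgroup κ K₀ n) ι,
          pointsMapOfEmb W ι ((ψ.1 (resGalSubgroupOfEmb (towerSubgroup κ K₀ n) ι τ) :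
              W.geomPrimaryTorsion p) : W.geomPoints) =
            (τ : Field.absoluteGaloisGroup ℚ_[p]) • Q₁ - Q₁) :
    c ∉ localKummerOverOfEmb W p (towerSubgroup κ K₀ n) ι
      (towerSignedLocalPointsOfEmb (towerSubgroup κ K₀) ι W (-1) n) := by
  have htors₀ : ∀ Q ∈ localFixedPointsOfEmb ι W (towerSubgroup κ K₀ 0), p • Q = 0 → Q = 0 := by
    rw [towerSubgroup_zero κ K₀]
    exact eq_zero_of_prime_smul_eq_zero_localFixedPointsOfEmb_padic_of_normal ι W hp2 M hΔ hA hWM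
      (galRange (K := K) K₀) hK₀0 hK₀
  exact not_mem_localKummerOverOfEmb_neg_one_of_kummer_generator_of_bottom ι W (towerSubgroup κ K₀)
    (towerSubgroup_antitone κ K₀) n hsum (hp.out.odd_of_ne_two hp2) htors₀
    (hidx_towerSubgroup κ K₀ ι n) hg hτ₀ hndiv hcg

/-- **The same for a globally minimal good supersingular `V/ℚ` read over `K`** (`W ⊗ ℚ̄_p = V ⊗ ℚ̄_p`,
`V.HasGoodReductionAtPrime p`, `V.frobeniusTrace p = 0`, `K₀/K` Galois of degree `< (p² − 1)/2`,
`p ≥ 3`): class-level transversality from `hsum` alone — NO torsion hypothesis, NO model hypothesis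
(file 8's `exists_goodSupersingularPadicModel`, `RelModel.index_galRange`).
[cite: Kobayashi2003, Def. 2.1 (p. 5), Prop. 8.12 ii) (pp. 17–18), Prop. 8.7 (p. 16)] -/
theorem not_mem_localKummerOverOfEmb_neg_one_of_kummer_generator_towerSubgroup_of_goodSupersingular
    [IsGalois K K₀] (hp2 : p ≠ 2) (V : WeierstrassCurve ℚ) [V.IsElliptic] [V.IsGloballyMinimal]
    (hgood : V.HasGoodReductionAtPrime p) (hap : V.frobeniusTrace p = 0)
    (hWV : W.baseChange (AlgebraicClosure ℚ_[p]) = V.baseChange (AlgebraicClosure ℚ_[p]))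
    (hK₀ : Module.finrank K K₀ < (p ^ 2 - 1) / 2) (n : ℕ)
    (hsum : localFixedPointsOfEmb ι W (towerSubgroup κ K₀ n) ≤
      towerSignedLocalPointsOfEmb (towerSubgroup κ K₀) ι W 1 n ⊔
        towerSignedLocalPointsOfEmb (towerSubgroup κ K₀) ι W (-1) n)
    {g : localPoints W ℚ_[p]} (hg : g ∈ localFixedPointsOfEmb ι W (towerSubgroup κ K₀ 0))
    {τ₀ : Field.absoluteGaloisGroup ℚ_[p]} (hτ₀ : τ₀ • g = -g)
    (hndiv : ∀ S ∈ localFixedPointsOfEmb ι W (towerSubgroup κ K₀ 0), g ≠ p • S)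
    {c : W.subgroupH1 p (towerSubgroup κ K₀ n)}
    (hcg : ∃ (ψ : contOneCocycles (discreteTopRep (towerSubgroup κ K₀ n) (W.geomPrimaryTorsion p)))
      (Q₁ : localPoints W ℚ_[p]) (j : ℕ),
      oneCocycleClass (discreteTopRep (towerSubgroup κ K₀ n) (W.geomPrimaryTorsion p)) ψ = c ∧
        p ^ (j + 1) • Q₁ = p ^ j • g ∧
        ∀ τ : localSubgroupOfEmb (towerSubgroup κ K₀ n) ι,
          pointsMapOfEmb W ι ((ψ.1 (resGalSubgroupOfEmb (towerSubgroup κ K₀ n) ι τ) :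
              W.geomPrimaryTorsion p) : W.geomPoints) =
            (τ : Field.absoluteGaloisGroup ℚ_[p]) • Q₁ - Q₁) :
    c ∉ localKummerOverOfEmb W p (towerSubgroup κ K₀ n) ι
      (towerSignedLocalPointsOfEmb (towerSubgroup κ K₀) ι W (-1) n) := by
  obtain ⟨M, hΔ, hA, hVM⟩ := exists_goodSupersingularPadicModel hp2 V hgood hap
  obtain ⟨hK₀0, hK₀'⟩ := index_galRange_ne_zero_and_lt (p := p) K₀ hK₀
  exact not_mem_localKummerOverOfEmb_neg_one_of_kummer_generator_towerSubgroup_padic κ K₀ ι W hp2 M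
    hΔ hA (hVM.trans hWV.symm) hK₀0 hK₀' n hsum hg hτ₀ hndiv hcg

end Summit.BirchSwinnertonDyer.Rank1Residual.Additive

end
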